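/-
Copyright (c) 2026. All rights reserved.
Released under Apache 2.0 license as described in the file LICENSE.
Authors: abc-iut cell, seat abc-iut-L4-t14 (gen 5; proof-only, row «HFIN-FREE»: the holomorphic geometric
column of [AbsTopIII] Prop 4.2 (i) / Cor 4.5 at the uniformised model WITHOUT the finite-fibre binder `hfin`).
-/
import Literature.AnabelianGeometry.AbsoluteAnabelian.ArchimedeanHolFieldFunctorGeometricPSLCusped
import Literature.AnabelianGeometry.AbsoluteAnabelian.ArchimedeanHolFieldFunctorGeometricOverIdRigidInstances
import HarnessLib

/-!
# [AbsTopIII] Prop 4.2 (i) at the uniformised model WITHOUT the finite-fibre hypothesis `hfin`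

S. Mochizuki, *Topics in absolute anabelian geometry III*, proof of Prop 4.2 (i) p. 106 l. 14–19 (kurims
`paper:url-5493eb38cbb7`; bib key `MochizukiAbsTopIII2015`): «the full subcategory of `EA` consisting of
objects that map to `X` may … be identified with the category of finite étale R-localizations `Loc_R(X)`
…. Thus, the id-rigidity of `EA` follows immediately from the slimness assertion of Lemma 4.3».

abc-iut-L4-t14's gen-3 holomorphic column (`HolRS.isIdRigid_mapsTo_pslQuotient_of_isSlimGroup`, p440098)
transported id-rigidity along the EQUIVALENCE `Loc(PSL₂(ℝ), Γ̄) ≌ {Y ∈ HolRS | Y → ℍ/Γ̄}` and therefore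
carried the binder `hfin` — «for EVERY `g ∈ PSL₂(ℝ)` with `gΛ̄₁g⁻¹ ≤ Λ̄₂` the index `[Λ̄₂ : gΛ̄₁g⁻¹]` is
finite» (finite fibres of `ℍ/gΛ̄₁g⁻¹ → ℍ/Λ̄₂`; true for finite-coarea `Γ̄`, but an ANALYTIC input: finite
hyperbolic area / cusps `= ℙ¹(ℚ)` — abc-iut-L4-t12's `hfin_of_isArithmetic`).  DIAGNOSIS (this file): the
id-rigidity argument itself — sign-free fullness (`exists_psl_of_hom`), naturality along the STRUCTURE
INCLUSIONS `[1] : Λ̄″ → Λ̄′` and the DECK TRANSFORMATIONS `[γ]`, `γ ∈ Γ̄`, hypothesis (Z) of the group model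
(`LocObj.CentralFamiliesTrivial`), then abc-iut-w6-d003's descent `isIdRigid_mapsTo_of_app_self_eq_id` with
abc-iut-L4-t12's slice id-rigidity `isIdRigid_over_of_isSlimGroup` — only ever needs the finiteness of
`[Λ̄₂ : gΛ̄₁g⁻¹]` for `g ∈ Γ̄`, which is INDEX ARITHMETIC inside `Γ̄` (conjugation by `γ ∈ Γ̄` preserves
the index in `Γ̄`).  PROOF-ONLY (no definition, no named fact):

* `HolRS.LocObj.finiteIndex_conjSubgroup_subgroupOf_of_mem` — for `g ∈ Γ̄` and finite-index `Λ̄₁, Λ̄₂ ≤ Γ̄`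
  with `gΛ̄₁g⁻¹ ≤ Λ̄₂`: `[Λ̄₂ : gΛ̄₁g⁻¹] < ∞` (group theory);
* `HolRS.psl_mul_inv_mem_of_forall_mk_smul_eq` — faithfulness: `q, q' ∈ PSL₂(ℝ)` inducing the same map
  `ℍ → ℍ/Λ̄` differ by an element of `Λ̄` (from the `PGL(2, ℝ)` form, p455652);
* ★ `HolRS.app_self_eq_id_of_centralFamiliesTrivial` — **(H1⁎) WITHOUT `hfin`**: under (Z) for
  `Loc(PSL₂(ℝ), Γ̄)`, every automorphism `α` of `𝟭_{{Y → ℍ/Γ̄}}` has `α_{ℍ/Γ̄} = 𝟙`;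
* `HolRS.exists_iso_pslQuotient_of_hom` — every `Y → ℍ/Γ̄` is `≅ ℍ/Λ̄` in `HolRS` (p440736's
  `exists_iso_pslLocFunctor_obj` verbatim, structure map `pslQuotientHom Λ̄ Γ̄ 1`);
* ★★ `HolRS.isIdRigid_mapsTo_pslQuotient_of_isFreeOrSurface_hfinFree`,
  `HolRS.isIdRigid_EA_mapsTo_pslQuotient_of_isFreeOrSurface_hfinFree`, `HolRS.cor_4_5_…_hfinFree` — the
  holomorphic column for `Γ̄` free-or-surface, non-abelian, acting freely and properly discontinuously, with
  the SINGLE residual hypothesis `hN : [N(Λ̄) : Λ̄] < ∞`; and `…_of_cusps_hfinFree` — PUNCTURED case with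
  residual (P)+(FC) ONLY (abc-iut-L4-d1), no arithmeticity, no finite area.

HONEST SCOPE: MODEL side of [AbsTopIII] §4 (model ≠ reconstruction); the RC twin is a separate file; orbi
objects and `EA` beyond one `X₀` untouched.  Classical; nothing here bears on [IUTchIII] Cor. 3.12.
-/

set_option autoImplicit false

noncomputable section

open scoped Manifold ContDiff Topology UpperHalfPlane MatrixGroups Matrix
open _root_.MulAction _root_.CategoryTheory
open Literature.AlgebraicGeometry.Frobenioids (IsSlimGroup)
open Literature.IUT.HodgeTheaters (profiniteCompletion IsFreeOrSurface IsFreeOfFiniteRank)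
open Matrix.ProjectiveSpecialLinearGroup (toPGL toPGL_injective)
open Literature.Geometry.Manifold.QuotientManifold (conjSubgroup)

namespace Literature.AnabelianGeometry.AbsoluteAnabelian

namespace HolRS

/-! ### Finite index for the morphisms actually used: `g ∈ Γ̄` -/

/-- **For `g ∈ Γ̄` the index `[Λ̄₂ : gΛ̄₁g⁻¹]` is finite** (`Λ̄₁, Λ̄₂ ≤ Γ̄` of finite index, `gΛ̄₁g⁻¹ ≤ Λ̄₂`):
conjugation by `g` is an automorphism of `Γ̄`, so `[Γ̄ : gΛ̄₁g⁻¹] = [Γ̄ : Λ̄₁] < ∞`, and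
`[Λ̄₂ : gΛ̄₁g⁻¹] · [Γ̄ : Λ̄₂] = [Γ̄ : gΛ̄₁g⁻¹]`.  (The structure inclusions `g = 1` and the deck
transformations `g ∈ Γ̄` of `Loc(PSL₂(ℝ), Γ̄)` are FINITE étale — no analytic input.)
[cite: MochizukiAbsTopIII2015, Proposition 4.2 (i) proof p.106] -/
theorem LocObj.finiteIndex_conjSubgroup_subgroupOf_of_mem {Γ : Subgroup PSL2R}
    (Λ₁ Λ₂ : _root_.Literature.AnabelianGeometry.AbsoluteAnabelian.LocObj Γ) {g : PSL2R} (hgΓ : g ∈ Γ)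
    (hg : ∀ x ∈ Λ₁.toSubgroup, g * x * g⁻¹ ∈ Λ₂.toSubgroup) :
    ((conjSubgroup g Λ₁.toSubgroup).subgroupOf Λ₂.toSubgroup).FiniteIndex := by
  set f : PSL2R →* PSL2R := (MulAut.conj g).toMonoidHom with hf
  have hfi : Function.Injective f := (MulAut.conj g).injective
  set H : Subgroup PSL2R := conjSubgroup g Λ₁.toSubgroup with hH
  have hHΛ₂ : H ≤ Λ₂.toSubgroup := by
    intro y hy
    obtain ⟨x, hx, rfl⟩ := Subgroup.mem_map.mp hy
    exact hg x hx
  -- `Γ̄.map (conj g) = Γ̄`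
  have hΓ : Γ.map f = Γ := by
    ext y
    constructor
    · rintro ⟨x, hx, rfl⟩
      exact Γ.mul_mem (Γ.mul_mem hgΓ hx) (Γ.inv_mem hgΓ)
    · intro hy
      refine ⟨g⁻¹ * y * g, Γ.mul_mem (Γ.mul_mem (Γ.inv_mem hgΓ) hy) hgΓ, ?_⟩
      change g * (g⁻¹ * y * g) * g⁻¹ = y
      group
  -- `[Γ̄ : H] = [Γ̄ : Λ̄₁] ≠ 0`
  have h1 : H.relIndex Γ ≠ 0 := by
    have := Subgroup.relIndex_map_map_of_injective Λ₁.toSubgroup Γ hfi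
    rw [hΓ] at this
    rw [hH, show conjSubgroup g Λ₁.toSubgroup = Λ₁.toSubgroup.map f from rfl, this]
    exact Λ₁.finiteIndex.index_ne_zero
  -- `[Λ̄₂ : H] · [Γ̄ : Λ̄₂] = [Γ̄ : H]`
  have h2 := Subgroup.relIndex_mul_relIndex H Λ₂.toSubgroup Γ hHΛ₂ Λ₂.le
  refine ⟨fun h0 => h1 ?_⟩
  rw [← h2, show H.relIndex Λ₂.toSubgroup = 0 from h0, zero_mul]

/-! ### Faithfulness in `PSL₂(ℝ)` -/

/-- **`q, q' ∈ PSL₂(ℝ)` inducing the same map `ℍ → ℍ/Λ̄` differ by an element of `Λ̄`** (from the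
`PGL(2, ℝ)` form `RC.mul_inv_mem_of_forall_mk_smul_eq`, p455652, along the injection `toPGL`).
[cite: MochizukiAbsTopIII2015, Proposition 4.2 (i) proof p.106] -/
theorem psl_mul_inv_mem_of_forall_mk_smul_eq (Λ : Subgroup PSL2R) [ProperlyDiscontinuousSMul Λ ℍ]
    [IsCancelSMul Λ ℍ] {q q' : PSL2R}
    (h : ∀ τ : ℍ, (Quotient.mk (orbitRel Λ ℍ) (q • τ)) = Quotient.mk (orbitRel Λ ℍ) (q' • τ)) :
    q' * q⁻¹ ∈ Λ := by
  have h' : ∀ τ : ℍ, (Quotient.mk (orbitRel Λ ℍ) (toPGL q • τ)) =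
      Quotient.mk (orbitRel Λ ℍ) (toPGL q' • τ) := fun τ => by
    rw [toPGL_smul, toPGL_smul]; exact h τ
  have hmem := RC.mul_inv_mem_of_forall_mk_smul_eq Λ h'
  rw [← map_inv, ← map_mul] at hmem
  exact (Subgroup.mem_map_iff_mem toPGL_injective).mp hmem

/-! ### (H1⁎) without `hfin` -/

section H1

variable (Γ : Subgroup PSL2R) [ProperlyDiscontinuousSMul Γ ℍ] [IsCancelSMul Γ ℍ]

/-- ★ **(H1⁎) at the uniformised holomorphic model, WITHOUT the finite-fibre hypothesis**: for
`Γ̄ ≤ PSL₂(ℝ)` acting freely and properly discontinuously on `ℍ`, under hypothesis (Z) of the group model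
`Loc(PSL₂(ℝ), Γ̄)` (`LocObj.CentralFamiliesTrivial`), every automorphism `α` of the identity functor of
«objects of `HolRS` mapping to `ℍ/Γ̄`» has `α_{ℍ/Γ̄} = 𝟙`.  The components at the objects `ℍ/Λ̄` are
`[τ] ↦ [x_Λ • τ]` (`exists_psl_of_hom`); naturality along the structure inclusions and the deck
transformations — FINITE étale by `LocObj.finiteIndex_conjSubgroup_subgroupOf_of_mem`, no `hfin` — makes
`(x_Λ)` a compatible `Γ̄`-central family in `N(Γ̄)`, trivial by (Z).
[cite: MochizukiAbsTopIII2015, Proposition 4.2 (i) proof p.106] -/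
theorem app_self_eq_id_of_centralFamiliesTrivial (hZ : LocObj.CentralFamiliesTrivial Γ)
    (α : 𝟭 (ObjectProperty.FullSubcategory fun Y : HolRS => Nonempty (Y ⟶ pslQuotient Γ)) ≅ 𝟭 _) :
    (α.hom.app (mapsToSelf (pslQuotient Γ))).hom = 𝟙 (pslQuotient Γ) := by
  classical
  let C := ObjectProperty.FullSubcategory fun Y : HolRS => Nonempty (Y ⟶ pslQuotient Γ)
  -- instances at the objects `Λ̄`
  have iPD : ∀ Λ : _root_.Literature.AnabelianGeometry.AbsoluteAnabelian.LocObj Γ,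
      ProperlyDiscontinuousSMul Λ.toSubgroup ℍ := fun Λ =>
    Subgroup.properlyDiscontinuousSMul_of_le ‹ProperlyDiscontinuousSMul Γ ℍ› Λ.le
  have iC : ∀ Λ : _root_.Literature.AnabelianGeometry.AbsoluteAnabelian.LocObj Γ,
      IsCancelSMul Λ.toSubgroup ℍ := fun Λ => isCancelSMul_of_le upperHalfPlane Γ Λ.le
  -- the structure morphisms `ℍ/Λ̄ → ℍ/Γ̄` (`g = 1`, finite index by group theory)
  have hle1 : ∀ Λ : _root_.Literature.AnabelianGeometry.AbsoluteAnabelian.LocObj Γ,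
      ∀ x ∈ Λ.toSubgroup, (1 : PSL2R) * x * 1⁻¹ ∈ (LocObj.top Γ).toSubgroup := fun Λ x hx => by
    simpa using Λ.le hx
  have iF1 : ∀ Λ : _root_.Literature.AnabelianGeometry.AbsoluteAnabelian.LocObj Γ,
      ((conjSubgroup (1 : PSL2R) Λ.toSubgroup).subgroupOf (LocObj.top Γ).toSubgroup).FiniteIndex :=
    fun Λ => LocObj.finiteIndex_conjSubgroup_subgroupOf_of_mem Λ (LocObj.top Γ) Γ.one_mem (hle1 Λ)
  let s : ∀ Λ : _root_.Literature.AnabelianGeometry.AbsoluteAnabelian.LocObj Γ,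
      pslQuotient Λ.toSubgroup ⟶ pslQuotient Γ := fun Λ =>
    haveI := iPD Λ; haveI := iC Λ; haveI := iF1 Λ
    pslQuotientHom Λ.toSubgroup (LocObj.top Γ).toSubgroup 1 (hle1 Λ)
  let A : _root_.Literature.AnabelianGeometry.AbsoluteAnabelian.LocObj Γ → C := fun Λ =>
    ⟨@pslQuotient Λ.toSubgroup (iPD Λ) (iC Λ), ⟨s Λ⟩⟩
  -- the components at the `ℍ/Λ̄` come from `PSL₂(ℝ)` (fullness)
  have key : ∀ Λ : _root_.Literature.AnabelianGeometry.AbsoluteAnabelian.LocObj Γ, ∃ q : PSL2R,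
      (∀ τ : ℍ, (α.hom.app (A Λ)).hom.toFun (Quotient.mk (orbitRel Λ.toSubgroup ℍ) τ) =
        Quotient.mk (orbitRel Λ.toSubgroup ℍ) (q • τ)) ∧
      ∀ x ∈ Λ.toSubgroup, q * x * q⁻¹ ∈ Λ.toSubgroup := by
    intro Λ
    haveI := iPD Λ; haveI := iC Λ
    exact exists_psl_of_hom Λ.toSubgroup Λ.toSubgroup (α.hom.app (A Λ)).hom
  choose x hx hxconj using key
  -- naturality along `[g] : Λ₁ → Λ₂` for the FINITE-index morphisms: `(g x_{Λ₁}) (x_{Λ₂} g)⁻¹ ∈ Λ̄₂`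
  have hnat : ∀ {Λ₁ Λ₂ : _root_.Literature.AnabelianGeometry.AbsoluteAnabelian.LocObj Γ} (g : PSL2R)
      (hg : ∀ y ∈ Λ₁.toSubgroup, g * y * g⁻¹ ∈ Λ₂.toSubgroup)
      [((conjSubgroup g Λ₁.toSubgroup).subgroupOf Λ₂.toSubgroup).FiniteIndex],
      g * x Λ₁ * (x Λ₂ * g)⁻¹ ∈ Λ₂.toSubgroup := by
    intro Λ₁ Λ₂ g hg _
    haveI := iPD Λ₁; haveI := iC Λ₁; haveI := iPD Λ₂; haveI := iC Λ₂
    let φ : A Λ₁ ⟶ A Λ₂ := ObjectProperty.homMk (pslQuotientHom Λ₁.toSubgroup Λ₂.toSubgroup g hg)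
    have hφ := α.hom.naturality φ
    refine psl_mul_inv_mem_of_forall_mk_smul_eq Λ₂.toSubgroup fun τ => ?_
    have e1 := congrArg (fun k : A Λ₁ ⟶ A Λ₂ => k.hom.toFun (Quotient.mk (orbitRel Λ₁.toSubgroup ℍ) τ)) hφ
    simp only [Functor.id_map, Functor.id_obj] at e1
    change (α.hom.app (A Λ₂)).hom.toFun ((pslQuotientHom Λ₁.toSubgroup Λ₂.toSubgroup g hg).toFun
        (Quotient.mk (orbitRel Λ₁.toSubgroup ℍ) τ)) =
      (pslQuotientHom Λ₁.toSubgroup Λ₂.toSubgroup g hg).toFun ((α.hom.app (A Λ₁)).hom.toFun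
        (Quotient.mk (orbitRel Λ₁.toSubgroup ℍ) τ)) at e1
    rw [hx Λ₁ τ, pslQuotientHom_toFun_mk, pslQuotientHom_toFun_mk, hx Λ₂] at e1
    rw [mul_smul, mul_smul]
    exact e1
  -- the component at `X` itself lies in `N(Γ̄)` (invertibility of `α_X`)
  have htop : x (LocObj.top Γ) ∈ Subgroup.normalizer (Γ : Set PSL2R) := by
    obtain ⟨qt, hqt, hqtconj⟩ := exists_psl_of_hom Γ Γ (α.inv.app (A (LocObj.top Γ))).hom
    have hcomp : ∀ τ : ℍ, Quotient.mk (orbitRel Γ ℍ) ((x (LocObj.top Γ) * qt) • τ) =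
        Quotient.mk (orbitRel Γ ℍ) ((1 : PSL2R) • τ) := by
      intro τ
      have e0 := congrArg (fun k : A (LocObj.top Γ) ⟶ A (LocObj.top Γ) =>
        k.hom.toFun (Quotient.mk (orbitRel Γ ℍ) τ)) (α.inv_hom_id_app (A (LocObj.top Γ)))
      change (α.hom.app (A (LocObj.top Γ))).hom.toFun ((α.inv.app (A (LocObj.top Γ))).hom.toFun
        (Quotient.mk (orbitRel Γ ℍ) τ)) = Quotient.mk (orbitRel Γ ℍ) τ at e0
      rw [hqt τ] at e0
      erw [hx (LocObj.top Γ)] at e0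
      rw [mul_smul, one_smul]
      exact e0
    have hmem : (1 : PSL2R) * (x (LocObj.top Γ) * qt)⁻¹ ∈ Γ := psl_mul_inv_mem_of_forall_mk_smul_eq Γ hcomp
    rw [one_mul, Subgroup.inv_mem_iff] at hmem
    rw [Subgroup.mem_normalizer_iff]
    intro y
    constructor
    · intro hy
      exact hxconj (LocObj.top Γ) y hy
    · intro hy
      have h3 : qt * ((x (LocObj.top Γ) * qt)⁻¹ * (x (LocObj.top Γ) * y * (x (LocObj.top Γ))⁻¹) *
          (x (LocObj.top Γ) * qt)) * qt⁻¹ = y := by group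
      rw [← h3]
      exact hqtconj _ (Γ.mul_mem (Γ.mul_mem (Γ.inv_mem hmem) hy) hmem)
  -- every component lies in `N(Γ̄)`: `x_Λ ∈ Γ̄ x_top` (naturality along the structure inclusion)
  have hxN : ∀ Λ : _root_.Literature.AnabelianGeometry.AbsoluteAnabelian.LocObj Γ,
      x Λ ∈ Subgroup.normalizer (Γ : Set PSL2R) := by
    intro Λ
    haveI := iF1 Λ
    have h1 := hnat (Λ₁ := Λ) (Λ₂ := LocObj.top Γ) 1 (hle1 Λ)
    rw [one_mul, mul_one] at h1
    have h3 : x Λ = (x Λ * (x (LocObj.top Γ))⁻¹) * x (LocObj.top Γ) := by group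
    rw [h3]
    exact (Subgroup.normalizer _).mul_mem (Subgroup.le_normalizer h1) htop
  -- apply (Z) to the family `x` at the object `Γ̄` itself
  have hconcl := hZ x (fun Λ _ => hxN Λ)
    (fun Λ' Λ'' _ _ hle => by
      -- compatibility from naturality along the inclusion `[1] : Λ'' → Λ'`
      have hle' : ∀ y ∈ Λ''.toSubgroup, (1 : PSL2R) * y * 1⁻¹ ∈ Λ'.toSubgroup := fun y hy => by
        simpa using hle hy
      haveI := LocObj.finiteIndex_conjSubgroup_subgroupOf_of_mem Λ'' Λ' Γ.one_mem hle'
      have h1 := hnat (Λ₁ := Λ'') (Λ₂ := Λ') 1 hle'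
      rw [one_mul, mul_one] at h1
      rw [← Subgroup.inv_mem_iff] at h1
      simpa using h1)
    (fun Λ' hΛ' γ hγ => by
      -- centrality from naturality along the deck transformation `[γ] : Λ' → Λ'`
      have hnormal : ∀ y ∈ Λ'.toSubgroup, γ * y * γ⁻¹ ∈ Λ'.toSubgroup := fun y hy => hΛ' γ hγ y hy
      haveI := LocObj.finiteIndex_conjSubgroup_subgroupOf_of_mem Λ' Λ' hγ hnormal
      have h1 := hnat (Λ₁ := Λ') (Λ₂ := Λ') γ hnormal
      rw [← Subgroup.inv_mem_iff] at h1
      have e3 : (γ * x Λ' * (x Λ' * γ)⁻¹)⁻¹ = x Λ' * γ * (x Λ')⁻¹ * γ⁻¹ := by group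
      rwa [e3] at h1)
    (LocObj.top Γ) (fun γ hγ y hy => Γ.mul_mem (Γ.mul_mem hγ hy) (Γ.inv_mem hγ))
  change x (LocObj.top Γ) ∈ Γ at hconcl
  -- conclude: `α_X [τ] = [x_top • τ] = [τ]`
  apply HolRS.Hom.ext
  funext p
  induction p using Quotient.inductionOn with
  | h τ =>
    change (α.hom.app (A (LocObj.top Γ))).hom.toFun (Quotient.mk (orbitRel Γ ℍ) τ) =
      Quotient.mk (orbitRel Γ ℍ) τ
    erw [hx (LocObj.top Γ) τ]
    exact Quotient.sound ⟨⟨x (LocObj.top Γ), hconcl⟩, rfl⟩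

/-! ### Essential surjectivity without `hfin` -/

/-- **Every `Y → ℍ/Γ̄` in `HolRS` is `≅ ℍ/Λ̄` for some finite-index `Λ̄ ≤ Γ̄`** (p440736's
`exists_iso_pslLocFunctor_obj` verbatim, the structure morphism written as `pslQuotientHom Λ̄ Γ̄ 1` — no
`hfin`). [cite: MochizukiAbsTopIII2015, Proposition 4.2 (i) proof p.106] -/
theorem exists_iso_pslQuotient_of_hom (Y : HolRS) (fY : Y ⟶ pslQuotient Γ) :
    ∃ Λ : _root_.Literature.AnabelianGeometry.AbsoluteAnabelian.LocObj Γ,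
      ∃ (_ : ProperlyDiscontinuousSMul Λ.toSubgroup ℍ) (_ : IsCancelSMul Λ.toSubgroup ℍ),
        Nonempty (pslQuotient Λ.toSubgroup ≅ Y) := by
  let π : ℍ → (pslQuotient Γ).carrier := Quotient.mk (orbitRel Γ ℍ)
  have hπ : IsCoveringMap π :=
    (isQuotientCoveringMap_quotientMk_of_properlyDiscontinuousSMul (G := Γ) (E := ℍ)).isCoveringMap
  have hdeck : ∀ γ ∈ Γ, ∀ m : ℍ, π (γ • m) = π m := fun γ hγ m =>
    Quotient.sound ⟨⟨γ, hγ⟩, rfl⟩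
  haveI : LocallyConnectedSpace (pslQuotient Γ).carrier :=
    inferInstanceAs (LocallyConnectedSpace (orbitRel.Quotient Γ ℍ))
  have horb : ∀ m m' : ℍ, π m = π m' → ∃ γ ∈ Γ, γ • m = m' := by
    intro m m' h
    obtain ⟨g, hg⟩ := Quotient.exact h
    exact ⟨((g⁻¹ : Γ) : PSL2R), (g⁻¹).2, by rw [← hg]; exact inv_smul_smul g m'⟩
  obtain ⟨y₀⟩ := (inferInstance : Nonempty Y.carrier)
  obtain ⟨m₀, hm₀⟩ := Quotient.exists_rep (fY.toFun y₀)
  have h0 : fY.toFun y₀ = π m₀ := hm₀.symm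
  obtain ⟨Λ, k, e, hΛΓ, hk, hpk, -, hΛ, -, hek, hpe, -⟩ :=
    Literature.Topology.CoveringSpaces.SimplyConnectedCover.exists_subgroup_homeomorph_orbitQuotient
      (Γ := Γ) hπ hdeck horb fY.isFiniteEtale.isCoveringMap h0
  haveI : (Λ.subgroupOf Γ).FiniteIndex :=
    Literature.Topology.CoveringSpaces.SimplyConnectedCover.finiteIndex_of_finite_fibre
      fY.isFiniteEtale.isCoveringMap hk.continuous hpk hdeck hΛ m₀ (fY.isFiniteEtale.finite_fibre _)
  let Λo : _root_.Literature.AnabelianGeometry.AbsoluteAnabelian.LocObj Γ := ⟨Λ, hΛΓ, inferInstance⟩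
  haveI iPD : ProperlyDiscontinuousSMul Λo.toSubgroup ℍ :=
    Subgroup.properlyDiscontinuousSMul_of_le ‹ProperlyDiscontinuousSMul Γ ℍ› Λo.le
  haveI iC : IsCancelSMul Λo.toSubgroup ℍ := isCancelSMul_of_le upperHalfPlane Γ Λo.le
  have hle1 : ∀ x ∈ Λo.toSubgroup, (1 : PSL2R) * x * 1⁻¹ ∈ (LocObj.top Γ).toSubgroup := fun x hx => by
    simpa using hΛΓ hx
  haveI := LocObj.finiteIndex_conjSubgroup_subgroupOf_of_mem Λo (LocObj.top Γ) Γ.one_mem hle1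
  haveI : ProperlyDiscontinuousSMul (LocObj.top Γ).toSubgroup ℍ := ‹ProperlyDiscontinuousSMul Γ ℍ›
  haveI : IsCancelSMul (LocObj.top Γ).toSubgroup ℍ := ‹IsCancelSMul Γ ℍ›
  let fΛ : pslQuotient Λo.toSubgroup ⟶ pslQuotient Γ :=
    pslQuotientHom Λo.toSubgroup (LocObj.top Γ).toSubgroup 1 hle1
  have hfΛ : ∀ m : ℍ, fΛ.toFun (Quotient.mk _ m) = Quotient.mk (orbitRel Γ ℍ) m := fun m => by
    change (pslQuotientHom Λo.toSubgroup (LocObj.top Γ).toSubgroup 1 hle1).toFun (Quotient.mk _ m) = _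
    rw [pslQuotientHom_toFun_mk, one_smul]
    rfl
  refine ⟨Λo, iPD, iC, ⟨isoOfHomeomorphOver fΛ fY e ?_⟩⟩
  funext z
  induction z using Quotient.inductionOn with
  | h m =>
    change fY.toFun (e (Quotient.mk _ m)) = fΛ.toFun (Quotient.mk _ m)
    rw [hpe m, hfΛ m]

/-! ### The holomorphic column for `Γ̄` free-or-surface, WITHOUT `hfin` -/

/-- ★ **«Objects of `HolRS` mapping to `ℍ/Γ̄`» is id-rigid — no `hfin`** — for `Γ̄` free of finite rank or
an orientable surface group, non-abelian, acting freely and properly discontinuously on `ℍ`, with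
`[N(Γ̄) : Γ̄] < ∞`: (H1⁎) above with (Z) discharged by abc-iut-L4-d1's free-or-surface normaliser shape and
`C_{PSL₂(ℝ)}(Γ̄) = 1`, then abc-iut-w6-d003's descent with abc-iut-L4-t12's slice id-rigidity from the
slimness of `π̂₁(ℍ/Γ̄) ≅ Γ̂`. [cite: MochizukiAbsTopIII2015, Proposition 4.2 (i) proof p.106] -/
theorem isIdRigid_mapsTo_pslQuotient_of_isFreeOrSurface_hfinFree (hΓ : IsFreeOrSurface Γ)
    (hab : ∃ a b : Γ, a * b ≠ b * a)
    [(Γ.subgroupOf (Subgroup.normalizer (Γ : Set PSL2R))).FiniteIndex] :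
    Literature.AnabelianGeometry.AbsoluteAnabelian.IsIdRigid
      (ObjectProperty.FullSubcategory fun Y : HolRS => Nonempty (Y ⟶ HolRS.pslQuotient Γ)) :=
  isIdRigid_mapsTo_of_app_self_eq_id (pslQuotient Γ)
    (app_self_eq_id_of_centralFamiliesTrivial Γ
      (LocObj.centralFamiliesTrivial_of_completion_normalizer
        (Literature.GroupTheory.eq_one_of_forall_commute_etaFn_normalizer_of_isFreeOrSurface Γ hΓ
          (forall_mem_normalizer_comm_eq_one Γ hab))))
    (isIdRigid_over_of_isSlimGroup (pslQuotient Γ) (Quotient.mk (orbitRel Γ ℍ) UpperHalfPlane.I)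
      (isSlimGroup_profiniteCompletion_fundamentalGroup_pslQuotient_of_isFreeOrSurface Γ hΓ hab))

/-- ★★ **The geometric `EA` over `X₀ = ℍ/Γ̄` is ID-RIGID — no `hfin`** — for `Γ̄` free of finite rank or an
orientable surface group, non-abelian, acting freely and properly discontinuously on `ℍ`, provided ONLY
`[N(Λ̄) : Λ̄] < ∞` for every finite-index `Λ̄ ≤ Γ̄` ([AbsTopIII] Prop 4.2 (i) at the uniformised
holomorphic model; every object `≅ ℍ/Λ̄` by `exists_iso_pslQuotient_of_hom`).
[cite: MochizukiAbsTopIII2015, Proposition 4.2 (i) proof p.106] -/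
theorem isIdRigid_EA_mapsTo_pslQuotient_of_isFreeOrSurface_hfinFree (hΓ : IsFreeOrSurface Γ)
    (hab : ∃ a b : Γ, a * b ≠ b * a)
    (hN : ∀ Λ : _root_.Literature.AnabelianGeometry.AbsoluteAnabelian.LocObj Γ,
      (Λ.toSubgroup.subgroupOf (Subgroup.normalizer (Λ.toSubgroup : Set PSL2R))).FiniteIndex) :
    Literature.AnabelianGeometry.AbsoluteAnabelian.IsIdRigid
      (HolRS.geometricAutHolFieldFunctor fun Y : HolRS => Nonempty (Y ⟶ HolRS.pslQuotient Γ)).EA := by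
  refine isIdRigid_EA_of_forall_isIdRigid_mapsTo _ fun X => ?_
  rw [isIdRigid_mapsTo_in_EA_iff]
  obtain ⟨fX⟩ := X.property
  obtain ⟨Λ, iPD, iC, ⟨e⟩⟩ := exists_iso_pslQuotient_of_hom Γ X.obj fX
  haveI := hN Λ
  have hP : (fun Y : HolRS => Nonempty (Y ⟶ X.obj)) =
      fun Y : HolRS => Nonempty (Y ⟶ pslQuotient Λ.toSubgroup) := by
    funext Y
    exact propext ⟨fun ⟨f⟩ => ⟨f ≫ e.inv⟩, fun ⟨f⟩ => ⟨f ≫ e.hom⟩⟩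
  rw [hP]
  exact isIdRigid_mapsTo_pslQuotient_of_isFreeOrSurface_hfinFree Λ.toSubgroup
    (HolRS.LocObj.isFreeOrSurface hΓ Λ) (HolRS.LocObj.exists_mul_ne_mul_of_isFreeOrSurface hΓ hab Λ)

/-- ★★ **[AbsTopIII] Cor 4.5 (i)–(v) over the geometric `EA` of `X₀ = ℍ/Γ̄` — no `hfin`** (`Γ̄`
free-or-surface, non-abelian; residual hypothesis `hN` only). [cite: MochizukiAbsTopIII2015, Corollary 4.5 pp.107–109] -/
theorem cor_4_5_geometric_mapsTo_pslQuotient_of_isFreeOrSurface_hfinFree (hΓ : IsFreeOrSurface Γ)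
    (hab : ∃ a b : Γ, a * b ≠ b * a)
    (hN : ∀ Λ : _root_.Literature.AnabelianGeometry.AbsoluteAnabelian.LocObj Γ,
      (Λ.toSubgroup.subgroupOf (Subgroup.normalizer (Λ.toSubgroup : Set PSL2R))).FiniteIndex) :
    Literature.AnabelianGeometry.AbsoluteAnabelian.AbsTopIII.Cor_4_5
      (Literature.AnabelianGeometry.AbsoluteAnabelian.archLogFrobeniusData
        (HolRS.geometricAutHolFieldFunctor fun Y : HolRS => Nonempty (Y ⟶ HolRS.pslQuotient Γ)))
      (Literature.AnabelianGeometry.AbsoluteAnabelian.archTelecoreData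
        (HolRS.geometricAutHolFieldFunctor fun Y : HolRS => Nonempty (Y ⟶ HolRS.pslQuotient Γ))) :=
  cor_4_5_geometric _ ⟨pslQuotient Γ, ⟨𝟙 _⟩⟩
    (isIdRigid_EA_mapsTo_pslQuotient_of_isFreeOrSurface_hfinFree Γ hΓ hab hN)

/-- ★★ **PUNCTURED case, no `hfin`**: `Γ̄` free-or-surface, non-abelian, acting freely and properly
discontinuously, with (P) a parabolic and (FC) finitely many cusp classes ⇒ the geometric `EA` over
`X₀ = ℍ/Γ̄` is ID-RIGID — residual = the cusp data ONLY (`hN` by abc-iut-L4-d1).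
[cite: MochizukiAbsTopIII2015, Proposition 4.2 (i) proof p.106] -/
theorem isIdRigid_EA_mapsTo_pslQuotient_of_cusps_hfinFree (hΓ : IsFreeOrSurface Γ)
    (hab : ∃ a b : Γ, a * b ≠ b * a)
    (hP : ∃ t : SL(2, ℝ), QuotientGroup.mk' (Subgroup.center SL(2, ℝ)) t ∈ Γ ∧
      (t : Matrix (Fin 2) (Fin 2) ℝ).IsParabolic)
    (hFC : ∃ F : Finset (Fin 2 → ℝ), ∀ t : SL(2, ℝ),
      QuotientGroup.mk' (Subgroup.center SL(2, ℝ)) t ∈ Γ → (t : Matrix (Fin 2) (Fin 2) ℝ).IsParabolic →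
      ∀ v : Fin 2 → ℝ, v ≠ 0 → (∃ c : ℝ, (t : Matrix (Fin 2) (Fin 2) ℝ) *ᵥ v = c • v) →
      ∃ g : SL(2, ℝ), QuotientGroup.mk' (Subgroup.center SL(2, ℝ)) g ∈ Γ ∧ ∃ w ∈ F, ∃ c : ℝ,
        (g : Matrix (Fin 2) (Fin 2) ℝ) *ᵥ v = c • w) :
    Literature.AnabelianGeometry.AbsoluteAnabelian.IsIdRigid
      (HolRS.geometricAutHolFieldFunctor fun Y : HolRS => Nonempty (Y ⟶ HolRS.pslQuotient Γ)).EA :=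
  isIdRigid_EA_mapsTo_pslQuotient_of_isFreeOrSurface_hfinFree Γ hΓ hab
    (LocObj.finiteIndex_subgroupOf_normalizer_of_cusps hΓ hab hP hFC)

/-- ★★ **Cor 4.5 (i)–(v), PUNCTURED case, no `hfin`** (residual = (P)+(FC) only).
[cite: MochizukiAbsTopIII2015, Corollary 4.5 pp.107–109] -/
theorem cor_4_5_geometric_mapsTo_pslQuotient_of_cusps_hfinFree (hΓ : IsFreeOrSurface Γ)
    (hab : ∃ a b : Γ, a * b ≠ b * a)
    (hP : ∃ t : SL(2, ℝ), QuotientGroup.mk' (Subgroup.center SL(2, ℝ)) t ∈ Γ ∧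
      (t : Matrix (Fin 2) (Fin 2) ℝ).IsParabolic)
    (hFC : ∃ F : Finset (Fin 2 → ℝ), ∀ t : SL(2, ℝ),
      QuotientGroup.mk' (Subgroup.center SL(2, ℝ)) t ∈ Γ → (t : Matrix (Fin 2) (Fin 2) ℝ).IsParabolic →
      ∀ v : Fin 2 → ℝ, v ≠ 0 → (∃ c : ℝ, (t : Matrix (Fin 2) (Fin 2) ℝ) *ᵥ v = c • v) →
      ∃ g : SL(2, ℝ), QuotientGroup.mk' (Subgroup.center SL(2, ℝ)) g ∈ Γ ∧ ∃ w ∈ F, ∃ c : ℝ,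
        (g : Matrix (Fin 2) (Fin 2) ℝ) *ᵥ v = c • w) :
    Literature.AnabelianGeometry.AbsoluteAnabelian.AbsTopIII.Cor_4_5
      (Literature.AnabelianGeometry.AbsoluteAnabelian.archLogFrobeniusData
        (HolRS.geometricAutHolFieldFunctor fun Y : HolRS => Nonempty (Y ⟶ HolRS.pslQuotient Γ)))
      (Literature.AnabelianGeometry.AbsoluteAnabelian.archTelecoreData
        (HolRS.geometricAutHolFieldFunctor fun Y : HolRS => Nonempty (Y ⟶ HolRS.pslQuotient Γ))) :=
  cor_4_5_geometric_mapsTo_pslQuotient_of_isFreeOrSurface_hfinFree Γ hΓ hab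
    (LocObj.finiteIndex_subgroupOf_normalizer_of_cusps hΓ hab hP hFC)

end H1

end HolRS

end Literature.AnabelianGeometry.AbsoluteAnabelian

end
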